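import Mathlib
import HarnessLib

/-!
# Elementary sums for the Hardy–Littlewood approximate functional equation (Titchmarsh §4.13)

Topic `Literature/NumberTheory/LFunctions`. Auxiliary file of a proof of Titchmarsh's
Theorem 4.13 (*The Theory of the Riemann Zeta-Function*, 2nd ed., §4.13). The proof in the book
sums the estimates of Lemma 4.3 over the frequencies `ν`:
"`O(∑_{ν=1}^∞ β/(ν(β+ν))) = O(∑_{ν≤β} 1/ν) + O(∑_{ν≥β} β/ν²) = O{log(β+2)} + O(1)`" (§4.7),
"`O((x^{1-σ}/t) ∑_{1≤ν≤y-η} ν/(ν - y)) = O((x^{1-σ} y log t)/t)`" (§4.13). This file provides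
such harmonic-type bounds in the explicit form used in the assembly, the existence of a point
with fractional part in `[1/4, 3/4]` in any interval of length `≥ 1/2` (used to keep
`y = t/(2πx)` at distance `≥ 1/4` from the integers, which replaces the book's use of Lemma 4.5
for the frequencies nearest to `y`), and the trivial bound `∑_{n≤X} n^{-1/2} ≤ 2√X`.
All statements are elementary.

## References

* E. C. Titchmarsh, *The Theory of the Riemann Zeta-Function*, 2nd ed. (rev. D. R. Heath-Brown),
  Oxford 1986, §4.7 and §4.13.
-/

noncomputable section

open Real Finset

namespace Literature.NumberTheory.LFunctions.AFE

/-- `∑_{ν=1}^n 1/ν ≤ 1 + log(n + 1)`. [folklore] -/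
theorem sum_Icc_inv_le_log (n : ℕ) :
    ∑ ν ∈ Finset.Icc 1 n, (1 : ℝ) / ν ≤ 1 + Real.log (n + 1) := by
  have h := harmonic_le_one_add_log n
  rw [harmonic_eq_sum_Icc] at h
  push_cast at h
  simp only [one_div]
  refine h.trans ?_
  rcases Nat.eq_zero_or_pos n with hn | hn
  · subst hn; simp
  · have : Real.log n ≤ Real.log (n + 1) := Real.log_le_log (by exact_mod_cast hn) (by linarith)
    linarith

/-- `∑_{m < ν ≤ V} 1/ν² ≤ 1/m` for `m ≥ 1` (telescoping). [folklore] -/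
theorem sum_Ioc_inv_sq_le {m : ℕ} (hm : 1 ≤ m) (V : ℕ) :
    ∑ ν ∈ Finset.Ioc m V, (1 : ℝ) / (ν : ℝ) ^ 2 ≤ 1 / m := by
  suffices h : ∀ V : ℕ, m ≤ V → ∑ ν ∈ Finset.Ioc m V, (1 : ℝ) / (ν : ℝ) ^ 2 ≤ 1 / m - 1 / V by
    rcases le_or_gt m V with hV | hV
    · have h1 := h V hV
      have h2 : (0 : ℝ) ≤ 1 / V := by positivity
      linarith
    · rw [Finset.Ioc_eq_empty (by omega), Finset.sum_empty]; positivity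
  intro V hV
  induction V, hV using Nat.le_induction with
  | base => simp
  | succ V hV ih =>
    rw [Finset.sum_Ioc_succ_top hV]
    have hV1 : (1 : ℝ) ≤ V := by exact_mod_cast (hm.trans hV)
    have key : (1 : ℝ) / ((V + 1 : ℕ) : ℝ) ^ 2 ≤ 1 / V - 1 / ((V + 1 : ℕ) : ℝ) := by
      push_cast
      rw [div_sub_div _ _ (by positivity) (by positivity), div_le_div_iff₀ (by positivity)
        (by positivity)]
      nlinarith
    linarith

/-- The telescoping identity behind `∑_{k ≥ 1} 1/(k(n₀+k)) ≤ H_{n₀}/n₀`: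
`∑_{k=1}^K (1/k - 1/(n₀+k)) + ∑_{j<n₀} 1/(K+1+j) = H_{n₀}`. [folklore] -/
theorem sum_inv_sub_inv_add_eq (n₀ K : ℕ) :
    (∑ k ∈ Finset.Icc 1 K, ((1 : ℝ) / k - 1 / (n₀ + k)))
      + ∑ j ∈ Finset.range n₀, (1 : ℝ) / (K + 1 + j) = ∑ j ∈ Finset.range n₀, (1 : ℝ) / (1 + j) := by
  induction K with
  | zero => simp
  | succ K ih =>
    rw [Finset.sum_Icc_succ_top (by omega), ← ih]
    have htel : ∑ j ∈ Finset.range n₀, (1 : ℝ) / (K + 1 + j)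
        = ∑ j ∈ Finset.range n₀, (1 : ℝ) / ((K + 1 : ℕ) + 1 + j)
          + (1 / (K + 1) - 1 / ((K + 1 : ℕ) + n₀)) := by
      have h := Finset.sum_range_sub' (fun j : ℕ => (1 : ℝ) / (K + 1 + j)) n₀
      simp only [Nat.cast_zero, add_zero] at h
      rw [Finset.sum_sub_distrib] at h
      have e : ∑ j ∈ Finset.range n₀, (1 : ℝ) / (K + 1 + ((j + 1 : ℕ) : ℝ))
          = ∑ j ∈ Finset.range n₀, (1 : ℝ) / ((K + 1 : ℕ) + 1 + j) := by
        apply Finset.sum_congr rfl; intro j _; push_cast; ring_nf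
      rw [e] at h
      push_cast at h ⊢
      linarith
    rw [htel]
    push_cast
    ring

/-- `H_{n} = ∑_{j<n} 1/(1+j) ≤ 1 + log(n + 1)`. [folklore] -/
theorem sum_range_inv_succ_le_log (n : ℕ) :
    ∑ j ∈ Finset.range n, (1 : ℝ) / (1 + j) ≤ 1 + Real.log (n + 1) := by
  have h := harmonic_le_one_add_log n
  unfold harmonic at h
  push_cast at h
  have e : ∑ j ∈ Finset.range n, (1 : ℝ) / (1 + j) = ∑ x ∈ Finset.range n, ((x : ℝ) + 1)⁻¹ := by
    apply Finset.sum_congr rfl; intro j _; rw [one_div, add_comm]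
  rw [e]
  refine h.trans ?_
  rcases Nat.eq_zero_or_pos n with hn | hn
  · subst hn; simp
  · have : Real.log n ≤ Real.log (n + 1) := Real.log_le_log (by exact_mod_cast hn) (by linarith)
    linarith

/-- `∑_{k=1}^K 1/(k (n₀ + k)) ≤ (1 + log(n₀+1))/n₀` for `n₀ ≥ 1`, uniformly in `K`. [folklore] -/
theorem sum_inv_mul_shift_le {n₀ : ℕ} (hn₀ : 1 ≤ n₀) (K : ℕ) :
    ∑ k ∈ Finset.Icc 1 K, (1 : ℝ) / (k * (n₀ + k)) ≤ (1 + Real.log (n₀ + 1)) / n₀ := by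
  have hn₀pos : (0 : ℝ) < n₀ := by exact_mod_cast hn₀
  have hterm : ∀ k ∈ Finset.Icc 1 K,
      (1 : ℝ) / (k * (n₀ + k)) = (1 / n₀) * (1 / k - 1 / (n₀ + k)) := by
    intro k hk
    have hk : (1 : ℝ) ≤ k := by exact_mod_cast (Finset.mem_Icc.1 hk).1
    field_simp
    ring
  rw [Finset.sum_congr rfl hterm, ← Finset.mul_sum]
  have hid := sum_inv_sub_inv_add_eq n₀ K
  have hT : 0 ≤ ∑ j ∈ Finset.range n₀, (1 : ℝ) / (K + 1 + j) :=
    Finset.sum_nonneg fun j _ => by positivity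
  have hH := sum_range_inv_succ_le_log n₀
  calc (1 : ℝ) / n₀ * ∑ k ∈ Finset.Icc 1 K, ((1 : ℝ) / k - 1 / (n₀ + k))
      ≤ 1 / n₀ * (1 + Real.log (n₀ + 1)) :=
        mul_le_mul_of_nonneg_left (by linarith) (by positivity)
    _ = (1 + Real.log (n₀ + 1)) / n₀ := by ring

/-- **The sum over the far frequencies** (Titchmarsh §4.7: "`∑_{ν ≥ β+η} β/(ν(ν-β)) = O(log(β+2))`"):
if `y > 0` has fractional part `≤ 3/4` and `n₀ = [y] + 1`, then for every `V`,
`∑_{ν=n₀}^{V} 1/(ν(ν - y)) ≤ (6 + log(y + 2))/y`. [cite: Titchmarsh1986, §4.7] -/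
theorem sum_far_le {y : ℝ} (hy : 0 < y) (hfr : Int.fract y ≤ 3 / 4) (V : ℕ) :
    ∑ ν ∈ Finset.Icc (⌊y⌋₊ + 1) V, (1 : ℝ) / (ν * (ν - y)) ≤ (6 + Real.log (y + 2)) / y := by
  set n₀ : ℕ := ⌊y⌋₊ + 1 with hn₀
  have hy0 : 0 ≤ y := hy.le
  have hfloor : (⌊y⌋₊ : ℝ) = y - Int.fract y := by
    rw [natCast_floor_eq_intCast_floor hy0, ← Int.self_sub_fract]
  have hn₀R : (n₀ : ℝ) = y + (1 - Int.fract y) := by rw [hn₀]; push_cast; rw [hfloor]; ring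
  have hfr0 : 0 ≤ Int.fract y := Int.fract_nonneg y
  have hgap : 1 / 4 ≤ (n₀ : ℝ) - y := by rw [hn₀R]; linarith
  have hn₀_le : (n₀ : ℝ) ≤ y + 1 := by rw [hn₀R]; linarith
  have hyn₀ : y < n₀ := by linarith
  have hn₀1 : 1 ≤ n₀ := by omega
  have hn₀pos : (0 : ℝ) < n₀ := by exact_mod_cast hn₀1
  rcases lt_or_ge V n₀ with hV | hV
  · rw [Finset.Icc_eq_empty (by omega), Finset.sum_empty]
    have : 0 ≤ Real.log (y + 2) := Real.log_nonneg (by linarith)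
    positivity
  -- split off the first term `ν = n₀`
  have hIcc : Finset.Icc n₀ V = insert n₀ (Finset.Icc (n₀ + 1) V) := by
    ext x; simp [Finset.mem_Icc]; omega
  have hnotin : n₀ ∉ Finset.Icc (n₀ + 1) V := by simp
  rw [hIcc, Finset.sum_insert hnotin]
  -- first term `≤ 4/n₀ ≤ 4/y`
  have h1 : (1 : ℝ) / (n₀ * (n₀ - y)) ≤ 4 / y := by
    rw [div_le_div_iff₀ (by nlinarith) hy]
    nlinarith
  -- remaining terms: `1/(ν(ν - y)) ≤ 1/((ν - n₀)(n₀ + (ν - n₀)))`, reindex `k = ν - n₀`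
  have h2 : ∑ ν ∈ Finset.Icc (n₀ + 1) V, (1 : ℝ) / (ν * (ν - y))
      ≤ ∑ k ∈ Finset.Icc 1 (V - n₀), (1 : ℝ) / (k * (n₀ + k)) := by
    have e : ∑ k ∈ Finset.Icc 1 (V - n₀), (1 : ℝ) / (k * (n₀ + k))
        = ∑ ν ∈ Finset.Icc (n₀ + 1) V, (1 : ℝ) / ((ν - n₀ : ℕ) * (n₀ + (ν - n₀ : ℕ))) := by
      apply Finset.sum_nbij' (fun k => k + n₀) (fun ν => ν - n₀)
      · intro k hk; simp [Finset.mem_Icc] at hk ⊢; omega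
      · intro ν hν; simp [Finset.mem_Icc] at hν ⊢; omega
      · intro k _; simp
      · intro ν hν; simp [Finset.mem_Icc] at hν; omega
      · intro k _; simp
    rw [e]
    apply Finset.sum_le_sum
    intro ν hν
    have hν : n₀ + 1 ≤ ν := (Finset.mem_Icc.1 hν).1
    have hcast : ((ν - n₀ : ℕ) : ℝ) = ν - n₀ := by rw [Nat.cast_sub (by omega)]
    rw [hcast, show (n₀ : ℝ) + (ν - n₀) = ν by ring]
    have hνR : (n₀ : ℝ) + 1 ≤ ν := by exact_mod_cast hν
    apply one_div_le_one_div_of_le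
    · nlinarith
    · rw [mul_comm]
      apply mul_le_mul_of_nonneg_left _ (by linarith)
      linarith
  have h3 := sum_inv_mul_shift_le hn₀1 (V - n₀)
  have h4 : (1 + Real.log (n₀ + 1)) / n₀ ≤ (2 + Real.log (y + 2)) / y := by
    have hlog : Real.log (n₀ + 1) ≤ Real.log (y + 2) := Real.log_le_log (by positivity) (by linarith)
    have hlog0 : 0 ≤ Real.log (n₀ + 1) := Real.log_nonneg (by linarith)
    calc (1 + Real.log (n₀ + 1)) / n₀ ≤ (1 + Real.log (n₀ + 1)) / y :=
          div_le_div_of_nonneg_left (by positivity) hy hyn₀.le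
      _ ≤ (2 + Real.log (y + 2)) / y := by
          apply div_le_div_of_nonneg_right _ hy.le; linarith
  calc (1 : ℝ) / (n₀ * (n₀ - y)) + ∑ ν ∈ Finset.Icc (n₀ + 1) V, (1 : ℝ) / (ν * (ν - y))
      ≤ 4 / y + (2 + Real.log (y + 2)) / y := by linarith
    _ = (6 + Real.log (y + 2)) / y := by ring

/-- **The sum over the near frequencies** (Titchmarsh §4.13: "`∑_{1≤ν≤y-η} ν/(ν-y)`"): if `y ≥ 1` has
fractional part `≥ 1/4`, then `∑_{ν=1}^{[y]} 1/(y - ν) ≤ 5 + log(y + 1)`. [cite: Titchmarsh1986, §4.13] -/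
theorem sum_near_le {y : ℝ} (hy : 1 ≤ y) (hfr : 1 / 4 ≤ Int.fract y) :
    ∑ ν ∈ Finset.Icc 1 ⌊y⌋₊, (1 : ℝ) / (y - ν) ≤ 5 + Real.log (y + 1) := by
  set n : ℕ := ⌊y⌋₊ with hn
  have hy0 : 0 ≤ y := by linarith
  have hfloor : (n : ℝ) = y - Int.fract y := by
    rw [hn, natCast_floor_eq_intCast_floor hy0, ← Int.self_sub_fract]
  have hfr1 : Int.fract y < 1 := Int.fract_lt_one y
  have hn_le : (n : ℝ) ≤ y := by rw [hfloor]; linarith [Int.fract_nonneg y]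
  -- reindex `k = n - ν`
  have e : ∑ ν ∈ Finset.Icc 1 n, (1 : ℝ) / (y - ν)
      = ∑ k ∈ Finset.range n, (1 : ℝ) / (Int.fract y + k) := by
    symm
    apply Finset.sum_nbij' (fun k => n - k) (fun ν => n - ν)
    · intro k hk; simp [Finset.mem_Icc] at hk ⊢; omega
    · intro ν hν; simp [Finset.mem_Icc] at hν ⊢; omega
    · intro k hk; simp at hk; omega
    · intro ν hν; simp [Finset.mem_Icc] at hν; omega
    · intro k hk
      simp only [Finset.mem_range] at hk
      rw [Nat.cast_sub hk.le, hfloor]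
      ring_nf
  rw [e]
  rcases Nat.eq_zero_or_pos n with h0 | hpos
  · rw [h0, Finset.sum_range_zero]
    have : 0 ≤ Real.log (y + 1) := Real.log_nonneg (by linarith)
    linarith
  -- split off `k = 0`
  obtain ⟨m, hm⟩ : ∃ m, n = m + 1 := ⟨n - 1, by omega⟩
  rw [hm, Finset.sum_range_succ']
  simp only [Nat.cast_add, Nat.cast_one, Nat.cast_zero, add_zero]
  have h1 : (1 : ℝ) / Int.fract y ≤ 4 := by
    rw [div_le_iff₀ (by linarith)]; linarith
  have h2 : ∑ k ∈ Finset.range m, (1 : ℝ) / (Int.fract y + (k + 1))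
      ≤ ∑ k ∈ Finset.range m, (1 : ℝ) / (1 + k) := by
    apply Finset.sum_le_sum
    intro k _
    apply one_div_le_one_div_of_le (by positivity)
    linarith
  have h3 := sum_range_inv_succ_le_log m
  have h4 : Real.log (m + 1) ≤ Real.log (y + 1) := by
    apply Real.log_le_log (by positivity)
    have : (m : ℝ) + 1 = n := by rw [hm]; push_cast; ring
    linarith
  linarith

/-- **A point with fractional part in `[1/4, 3/4]`** in any interval of length `≥ 1/2`. [folklore] -/
theorem exists_fract_mem_Icc {L U : ℝ} (h : L + 1 / 2 ≤ U) :
    ∃ z : ℝ, L ≤ z ∧ z ≤ U ∧ 1 / 4 ≤ Int.fract z ∧ Int.fract z ≤ 3 / 4 := by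
  have hf0 : 0 ≤ Int.fract L := Int.fract_nonneg L
  have hf1 : Int.fract L < 1 := Int.fract_lt_one L
  have hL : L = ⌊L⌋ + Int.fract L := (Int.floor_add_fract L).symm
  -- `fract (L + d) = fract L + d` if `fract L + d < 1`, `= fract L + d - 1` if `≥ 1`
  have key : ∀ d : ℝ, 0 ≤ d → d < 1 →
      (Int.fract L + d < 1 → Int.fract (L + d) = Int.fract L + d)
        ∧ (1 ≤ Int.fract L + d → Int.fract (L + d) = Int.fract L + d - 1) := by
    intro d hd0 hd1
    constructor
    · intro hlt
      nth_rw 1 [hL]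
      rw [add_assoc, Int.fract_intCast_add, Int.fract_eq_self.2 ⟨by linarith, hlt⟩]
    · intro hge
      nth_rw 1 [hL]
      rw [add_assoc, Int.fract_intCast_add]
      have e1 : Int.fract L + d = (Int.fract L + d - 1) + ((1 : ℤ) : ℝ) := by
        push_cast; ring
      nth_rw 1 [e1]
      rw [Int.fract_add_intCast, Int.fract_eq_self.2 ⟨by linarith, by linarith⟩]
  by_cases h1 : Int.fract L < 1 / 4
  · refine ⟨L + 1 / 4, by linarith, by linarith, ?_, ?_⟩ <;>
      rw [(key (1 / 4) (by norm_num) (by norm_num)).1 (by linarith)] <;> linarith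
  by_cases h2 : Int.fract L ≤ 1 / 2
  · refine ⟨L + 1 / 4, by linarith, by linarith, ?_, ?_⟩ <;>
      rw [(key (1 / 4) (by norm_num) (by norm_num)).1 (by linarith)] <;> linarith
  by_cases h3 : Int.fract L < 3 / 4
  · -- `fract L ∈ (1/2, 3/4)`: take `d = 3/4 - fract L ∈ (0, 1/4)`, landing at `3/4`
    refine ⟨L + (3 / 4 - Int.fract L), by linarith, by linarith, ?_, ?_⟩ <;>
      rw [(key (3 / 4 - Int.fract L) (by linarith) (by linarith)).1 (by linarith)] <;> linarith
  · -- `fract L ∈ [3/4, 1)`: take `d = 1/2`, landing in `[1/4, 1/2)`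
    refine ⟨L + 1 / 2, by linarith, by linarith, ?_, ?_⟩ <;>
      rw [(key (1 / 2) (by norm_num) (by norm_num)).2 (by linarith)] <;> linarith

/-- `∑_{n=1}^X n^{-1/2} ≤ 2√X`. [folklore] -/
theorem sum_Icc_rpow_neg_half_le (X : ℕ) :
    ∑ n ∈ Finset.Icc 1 X, (n : ℝ) ^ (-(1 / 2 : ℝ)) ≤ 2 * Real.sqrt X := by
  induction X with
  | zero => simp
  | succ X ih =>
    rw [Finset.sum_Icc_succ_top (by omega)]
    have hX : (0 : ℝ) ≤ X := Nat.cast_nonneg X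
    have hsq : Real.sqrt X ≤ Real.sqrt (X + 1) := Real.sqrt_le_sqrt (by linarith)
    have hpos : 0 < Real.sqrt ((X : ℝ) + 1) := Real.sqrt_pos.2 (by linarith)
    have hterm : ((X + 1 : ℕ) : ℝ) ^ (-(1 / 2 : ℝ)) = (Real.sqrt (X + 1))⁻¹ := by
      push_cast
      rw [Real.rpow_neg (by linarith), ← Real.sqrt_eq_rpow]
    rw [hterm]
    -- `1/√(X+1) ≤ 2(√(X+1) - √X)` since `√(X+1) + √X ≤ 2√(X+1)` and `(√(X+1)-√X)(√(X+1)+√X) = 1`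
    have hprod : (Real.sqrt (X + 1) - Real.sqrt X) * (Real.sqrt (X + 1) + Real.sqrt X) = 1 := by
      have h1 : Real.sqrt (X + 1) ^ 2 = X + 1 := Real.sq_sqrt (by linarith)
      have h2 : Real.sqrt X ^ 2 = X := Real.sq_sqrt hX
      nlinarith
    have hkey : (Real.sqrt (X + 1))⁻¹ ≤ 2 * (Real.sqrt (X + 1) - Real.sqrt X) := by
      rw [inv_le_iff_one_le_mul₀ hpos]
      nlinarith [Real.sqrt_nonneg X]
    push_cast
    linarith

end Literature.NumberTheory.LFunctions.AFE
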